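import Summits.Ventures.HodgeRepro2.T5HeckeCellFiltration
import Summits.Ventures.HodgeRepro2.T5UnitaryThreeCorner
import Summits.Ventures.HodgeRepro2.T5UnitaryGroupIsometry

/-!
# The top coefficient of `T₁ · Tₙ`, part 1: the matrix lemma
(cell pub-hodge-repro2, seat p3)

Tier-5 N3 support. Seat p8's T5-187 `aeval_bijective_of_top_coeff` states the Satake «algebra half» —
`H(U(antidiag(1, u, 1)), K) = k[T₁]` — modulo the TOP COEFFICIENT `c_{n+1} = 1` of `T₁ · Tₙ`, which p8's T5-5x
expresses as the count `#{x K ⊆ K aₙ K : x⁻¹ a_{n+1} ∈ K a₁ K}` (`coeff_doubleCosetOp_mul_apply_single_one`),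
`aₘ = diag(ϖ^m, 1, ϖ^{-m})` (p8's `cell hϖ m`). This file proves the matrix heart of `c_{n+1} = 1`:
* **`isInteger_conj_cell_of_clears`** — for `m ∈ U(antidiag(1, u, 1))` with integral entries: if `ϖ` clears
  `aₙ⁻¹ m a_{n+1}` (every entry has valuation `≥ −1`, p8's `Clears`), then `aₙ⁻¹ m aₙ` has integral entries — i.e.
  `m ∈ aₙ K aₙ⁻¹`. Eight of the nine entries are read off directly; the `(0, 1)` entry needs the unitary
  relations (columns `1, 2` and `0, 2` of `mᴴ J m = J`) and the fact that `star(m₀₀) m₂₂ ≡ 1 mod ϖ` is a unit.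
* the cell algebra `cell_mul_cell`, `inv_cell_mul_cell_succ` (`aₙ⁻¹ a_{n+1} = a₁`), `coe_cell'`, `coe_cell_inv`
  (the cells and their inverses as diagonal matrices) and `diagonalUnit_mul` / `diagonalUnit_inv`.
File 187 turns this into the count and discharges p8's hypothesis.

Mathlib + seat p8's T5-134 / T5-136 / T5-143 / T5-187 and their imports; no display; no device.
§8(d): uses an L-value-free non-vanishing device: NO.
-/

namespace Summit.Ventures.HodgeRepro2.T5InertTopCoefficientMatrix

open Matrix
open Summit.Ventures.HodgeRepro2.T5CartanUniformiser Summit.Ventures.HodgeRepro2.T5CartanCellsDistinct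
  Summit.Ventures.HodgeRepro2.T5HeckeBasisCells Summit.Ventures.HodgeRepro2.T5HermitianThreeElements
  Summit.Ventures.HodgeRepro2.T5UnitaryGroupForm Summit.Ventures.HodgeRepro2.T5UnitaryThreeCorner
  Summit.Ventures.HodgeRepro2.T5UnitaryGroupIsometry

/-! ## Diagonal units -/

section Diagonal

variable {R : Type*} [CommRing R] {ι : Type*} [Fintype ι] [DecidableEq ι]

/-- `diag(u) · diag(v) = diag(u v)` in `GL`. -/
theorem diagonalUnit_mul (u v : ι → Rˣ) : diagonalUnit u * diagonalUnit v = diagonalUnit (u * v) := by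
  ext1
  simp only [Units.val_mul, coe_diagonalUnit, Matrix.diagonal_mul_diagonal, Pi.mul_apply]

/-- `diag(1) = 1` in `GL`. -/
theorem diagonalUnit_one : diagonalUnit (1 : ι → Rˣ) = 1 := by
  ext1
  simp only [coe_diagonalUnit, Pi.one_apply, Units.val_one, Matrix.diagonal_one]

/-- `diag(u)⁻¹ = diag(u⁻¹)` in `GL`. -/
theorem diagonalUnit_inv (u : ι → Rˣ) : (diagonalUnit u)⁻¹ = diagonalUnit u⁻¹ := by
  rw [inv_eq_iff_mul_eq_one, diagonalUnit_mul, mul_inv_cancel, diagonalUnit_one]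

end Diagonal

/-! ## The cells `aₘ = diag(ϖ^m, 1, ϖ^{-m})` -/

section Cells

variable {R E : Type*} [CommRing R] [Field E] [Algebra R E] [IsFractionRing R E] {ϖ : R}
  (hϖ : Irreducible ϖ)

/-- `aₖ · aₗ = a_{k+l}`. -/
theorem cell_mul_cell (k l : ℕ) :
    (cell hϖ k : GL (Fin 3) E) * cell hϖ l = cell hϖ (k + l) := by
  rw [← diagonalUnit_eq_cell, ← diagonalUnit_eq_cell, ← diagonalUnit_eq_cell, diagonalUnit_mul]
  congr 1
  funext i
  fin_cases i
  · simp only [Pi.mul_apply, Fin.zero_eta, Matrix.cons_val_zero, ← _root_.zpow_add]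
    rw [Nat.cast_add]
  · simp only [Pi.mul_apply, Fin.mk_one, Matrix.cons_val_one, Matrix.cons_val_zero, zpow_zero, mul_one]
  · simp only [Pi.mul_apply, Fin.reduceFinMk, Matrix.cons_val_two, Matrix.tail_cons, Matrix.head_cons,
      ← _root_.zpow_add]
    congr 1
    push_cast
    ring

/-- `aₙ⁻¹ · a_{n+1} = a₁`. -/
theorem inv_cell_mul_cell_succ (n : ℕ) :
    (cell hϖ n : GL (Fin 3) E)⁻¹ * cell hϖ (n + 1) = cell hϖ 1 := by
  rw [← cell_mul_cell hϖ n 1, ← mul_assoc, inv_mul_cancel, one_mul]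

/-- The cell `aₖ` as a diagonal matrix. -/
theorem coe_cell' (k : ℕ) :
    ((cell hϖ k : GL (Fin 3) E) : Matrix (Fin 3) (Fin 3) E) =
      Matrix.diagonal fun i => (algebraMap R E ϖ) ^ (![(k : ℤ), 0, -(k : ℤ)] i) := by
  rw [← diagonalUnit_eq_cell, coe_diagonalUnit]
  congr 1
  funext i
  rw [Units.val_zpow_eq_zpow_val]
  rfl

/-- The inverse cell `aₖ⁻¹` as a diagonal matrix. -/
theorem coe_cell_inv (k : ℕ) :
    (((cell hϖ k : GL (Fin 3) E)⁻¹ : GL (Fin 3) E) : Matrix (Fin 3) (Fin 3) E) =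
      Matrix.diagonal fun i => (algebraMap R E ϖ) ^ (-(![(k : ℤ), 0, -(k : ℤ)] i)) := by
  rw [← diagonalUnit_eq_cell, diagonalUnit_inv, coe_diagonalUnit]
  congr 1
  funext i
  rw [Pi.inv_apply, Units.val_inv_eq_inv_val, Units.val_zpow_eq_zpow_val, ← _root_.zpow_neg]
  rfl

end Cells

/-! ## The matrix lemma -/

section Matrix

variable {R E : Type*} [CommRing R] [IsDomain R] [IsDiscreteValuationRing R] [Field E] [StarRing E]
  [Algebra R E] [IsFractionRing R E]

omit [StarRing E] in
/-- `π^{-a} · x · π^{a} = x`. -/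
theorem zpow_neg_mul_mul_zpow {π : E} (hπ : π ≠ 0) (x : E) (a : ℤ) : π ^ (-a) * x * π ^ a = x := by
  rw [mul_comm, ← mul_assoc, ← zpow_add₀ hπ, add_neg_cancel, zpow_zero, one_mul]

/-- An element `r₀ ∈ R` with `r₀ + ϖ y₀ = 1` is a unit. -/
theorem isUnit_of_add_irreducible_mul_eq_one {ϖ : R} (hϖ : Irreducible ϖ) {r₀ y₀ : R}
    (h : r₀ + ϖ * y₀ = 1) : IsUnit r₀ := by
  rcases IsLocalRing.isUnit_or_isUnit_of_add_one h with hr | hr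
  · exact hr
  · exact absurd (isUnit_of_mul_isUnit_left hr) hϖ.not_isUnit

/-- **The `(0, 1)` entry.** Let `π = ϖ` in `E` (`star π = π`), `n ≥ 1`, and let `m` be a matrix with integral
entries satisfying the two unitary relations of `mᴴ · antidiag(1, u, 1) · m = antidiag(1, u, 1)` for the column
pairs `(1, 2)` and `(0, 2)`; if `m₁₂ π^{-n}` and `m₀₂ π^{-2n}` are integral, so is `m₀₁ π^{-n}`. -/
theorem isInteger_entry_zero_one (hstar : ∀ x : E, IsLocalization.IsInteger R x →
      IsLocalization.IsInteger R (star x)) {u : E} (hu : IsLocalization.IsInteger R u)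
    {ϖ : R} (hϖ : Irreducible ϖ) (hs : star (algebraMap R E ϖ) = algebraMap R E ϖ) {n : ℕ} (hn : 1 ≤ n)
    {m : Matrix (Fin 3) (Fin 3) E} (hm : ∀ i j, IsLocalization.IsInteger R (m i j))
    (h12 : star (m 0 1) * m 2 2 + star (m 1 1) * u * m 1 2 + star (m 2 1) * m 0 2 = 0)
    (h02 : star (m 0 0) * m 2 2 + star (m 1 0) * u * m 1 2 + star (m 2 0) * m 0 2 = 1)
    (hm12 : IsLocalization.IsInteger R (m 1 2 * (algebraMap R E ϖ) ^ (-(n : ℤ))))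
    (hm02 : IsLocalization.IsInteger R (m 0 2 * (algebraMap R E ϖ) ^ (-((2 * n : ℕ) : ℤ)))) :
    IsLocalization.IsInteger R (m 0 1 * (algebraMap R E ϖ) ^ (-(n : ℤ))) := by
  set π : E := algebraMap R E ϖ with hπ
  have hπ0 : π ≠ 0 := by
    rw [hπ]
    exact (map_ne_zero_iff _ (IsFractionRing.injective R E)).2 hϖ.ne_zero
  have hπint : ∀ a : ℤ, 0 ≤ a → IsLocalization.IsInteger R (π ^ a) := fun a ha =>
    (isInteger_zpow_iff hϖ a).2 ha
  -- `m₁₂ π⁻¹`, `m₀₂ π⁻¹`, `m₀₂ π^{-n}` are integral (`n ≥ 1`)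
  have hm12' : IsLocalization.IsInteger R (m 1 2 * π⁻¹) := by
    have : m 1 2 * π⁻¹ = m 1 2 * π ^ (-(n : ℤ)) * π ^ ((n : ℤ) - 1) := by
      rw [mul_assoc, ← zpow_add₀ hπ0, ← _root_.zpow_neg_one]
      congr 2
      ring
    rw [this]
    exact IsLocalization.isInteger_mul hm12 (hπint _ (by omega))
  have hm02' : IsLocalization.IsInteger R (m 0 2 * π⁻¹) := by
    have : m 0 2 * π⁻¹ = m 0 2 * π ^ (-((2 * n : ℕ) : ℤ)) * π ^ ((2 * n : ℤ) - 1) := by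
      rw [mul_assoc, ← zpow_add₀ hπ0, ← _root_.zpow_neg_one]
      congr 2
      push_cast
      ring
    rw [this]
    exact IsLocalization.isInteger_mul hm02 (hπint _ (by omega))
  have hm02n : IsLocalization.IsInteger R (m 0 2 * π ^ (-(n : ℤ))) := by
    have : m 0 2 * π ^ (-(n : ℤ)) = m 0 2 * π ^ (-((2 * n : ℕ) : ℤ)) * π ^ (n : ℤ) := by
      rw [mul_assoc, ← zpow_add₀ hπ0]
      congr 2
      push_cast
      ring
    rw [this]
    exact IsLocalization.isInteger_mul hm02 (hπint _ (by omega))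
  -- `A := star(m₀₀) m₂₂ = 1 − π y` with `y` integral, hence `A` is a unit of `R`
  obtain ⟨a₀, ha₀⟩ := IsLocalization.isInteger_mul (hstar _ (hm 0 0)) (hm 2 2)
  obtain ⟨y₀, hy₀⟩ := IsLocalization.isInteger_add
    (IsLocalization.isInteger_mul (IsLocalization.isInteger_mul (hstar _ (hm 1 0)) hu) hm12')
    (IsLocalization.isInteger_mul (hstar _ (hm 2 0)) hm02')
  have hrel : a₀ + ϖ * y₀ = 1 := by
    apply IsFractionRing.injective R E
    rw [map_add, map_mul, map_one, ha₀, hy₀, ← hπ, ← h02]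
    field_simp
    ring
  have ha₀unit : IsUnit a₀ := isUnit_of_add_irreducible_mul_eq_one hϖ hrel
  have hAinv : IsLocalization.IsInteger R (star (m 0 0) * m 2 2)⁻¹ := by
    rw [← ha₀]
    exact isInteger_inv_of_isUnit ha₀unit
  have hA0 : star (m 0 0) * m 2 2 ≠ 0 := by
    rw [← ha₀]
    exact (map_ne_zero_iff _ (IsFractionRing.injective R E)).2 ha₀unit.ne_zero
  have hm22 : m 2 2 ≠ 0 := right_ne_zero_of_mul hA0
  have hm00 : star (m 0 0) ≠ 0 := left_ne_zero_of_mul hA0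
  -- `m₂₂⁻¹` is integral
  have hm22inv : IsLocalization.IsInteger R (m 2 2)⁻¹ := by
    have : (m 2 2)⁻¹ = star (m 0 0) * (star (m 0 0) * m 2 2)⁻¹ := by
      field_simp
    rw [this]
    exact IsLocalization.isInteger_mul (hstar _ (hm 0 0)) hAinv
  -- `star(m₀₁) m₂₂ π^{-n}` is integral by the relation of the columns `1, 2`
  have hrel12 : star (m 0 1) * m 2 2 * π ^ (-(n : ℤ)) =
      -(star (m 1 1) * u * (m 1 2 * π ^ (-(n : ℤ))) + star (m 2 1) * (m 0 2 * π ^ (-(n : ℤ)))) := by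
    have : star (m 0 1) * m 2 2 = -(star (m 1 1) * u * m 1 2 + star (m 2 1) * m 0 2) := by
      linear_combination h12
    rw [this]
    ring
  have hint12 : IsLocalization.IsInteger R (star (m 0 1) * m 2 2 * π ^ (-(n : ℤ))) := by
    rw [hrel12]
    exact isInteger_neg (IsLocalization.isInteger_add
      (IsLocalization.isInteger_mul (IsLocalization.isInteger_mul (hstar _ (hm 1 1)) hu) hm12)
      (IsLocalization.isInteger_mul (hstar _ (hm 2 1)) hm02n))
  -- divide by `m₂₂`, then apply the star
  have hstar01 : IsLocalization.IsInteger R (star (m 0 1) * π ^ (-(n : ℤ))) := by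
    have : star (m 0 1) * π ^ (-(n : ℤ)) = star (m 0 1) * m 2 2 * π ^ (-(n : ℤ)) * (m 2 2)⁻¹ := by
      field_simp
    rw [this]
    exact IsLocalization.isInteger_mul hint12 hm22inv
  have := hstar _ hstar01
  rwa [star_mul, star_star, star_zpow₀, hs, mul_comm] at this

/-- **The matrix lemma.** For `m ∈ U(antidiag(1, u, 1))` with integral entries: if `ϖ` clears `aₙ⁻¹ m a_{n+1}`
(p8's `Clears`), then `aₙ⁻¹ m aₙ` has integral entries. -/
theorem isInteger_conj_cell_of_clears (hstar : ∀ x : E, IsLocalization.IsInteger R x →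
      IsLocalization.IsInteger R (star x)) {u : E} (hu : IsLocalization.IsInteger R u)
    {ϖ : R} (hϖ : Irreducible ϖ) (hs : star (algebraMap R E ϖ) = algebraMap R E ϖ) (n : ℕ)
    {m : Matrix (Fin 3) (Fin 3) E} (hm : ∀ i j, IsLocalization.IsInteger R (m i j))
    (hmU : m.conjTranspose * J3 u * m = J3 u)
    (hcl : Clears R (algebraMap R E ϖ)
      ((((cell hϖ n : GL (Fin 3) E)⁻¹ : GL (Fin 3) E) : Matrix (Fin 3) (Fin 3) E) * m *
        ((cell hϖ (n + 1) : GL (Fin 3) E) : Matrix (Fin 3) (Fin 3) E))) :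
    ∀ i j, IsLocalization.IsInteger R
      (((((cell hϖ n : GL (Fin 3) E)⁻¹ : GL (Fin 3) E) : Matrix (Fin 3) (Fin 3) E) * m *
        ((cell hϖ n : GL (Fin 3) E) : Matrix (Fin 3) (Fin 3) E)) i j) := by
  rw [clears_iff, coe_cell_inv, coe_cell'] at hcl
  rw [coe_cell_inv, coe_cell']
  set π : E := algebraMap R E ϖ with hπ
  have hπ0 : π ≠ 0 := by
    rw [hπ]
    exact (map_ne_zero_iff _ (IsFractionRing.injective R E)).2 hϖ.ne_zero
  have hπint : ∀ a : ℤ, 0 ≤ a → IsLocalization.IsInteger R (π ^ a) := fun a ha =>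
    (isInteger_zpow_iff hϖ a).2 ha
  -- the two unitary relations
  have h12 : star (m 0 1) * m 2 2 + star (m 1 1) * u * m 1 2 + star (m 2 1) * m 0 2 = 0 := by
    have := congrFun (congrFun hmU 1) 2
    simp [J3_eq, Matrix.mul_apply, Fin.sum_univ_three] at this
    linear_combination this
  have h02 : star (m 0 0) * m 2 2 + star (m 1 0) * u * m 1 2 + star (m 2 0) * m 0 2 = 1 := by
    have := congrFun (congrFun hmU 0) 2
    simp [J3_eq, Matrix.mul_apply, Fin.sum_univ_three] at this
    linear_combination this
  -- the cleared entries `(0, 2)`, `(1, 2)`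
  have hc02 := hcl 0 2
  have hc12 := hcl 1 2
  simp only [Matrix.mul_diagonal, Matrix.diagonal_mul, Fin.isValue, Matrix.cons_val_zero,
    Matrix.cons_val_one, Matrix.head_cons, Matrix.cons_val_two, Matrix.tail_cons, neg_zero, zpow_zero,
    one_mul] at hc02 hc12
  have hm02 : IsLocalization.IsInteger R (m 0 2 * π ^ (-((2 * n : ℕ) : ℤ))) := by
    convert hc02 using 1
    simp only [_root_.zpow_neg, zpow_natCast]
    field_simp
    ring
  have hm12 : IsLocalization.IsInteger R (m 1 2 * π ^ (-(n : ℤ))) := by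
    convert hc12 using 1
    simp only [_root_.zpow_neg, zpow_natCast]
    field_simp
    ring
  intro i j
  fin_cases i <;> fin_cases j <;>
    simp only [Matrix.mul_diagonal, Matrix.diagonal_mul, Fin.zero_eta, Fin.mk_one, Fin.reduceFinMk,
      Fin.isValue, Matrix.cons_val_zero, Matrix.cons_val_one, Matrix.head_cons, Matrix.cons_val_two,
      Matrix.tail_cons, neg_zero, zpow_zero, mul_one, one_mul, neg_neg]
  · -- (0, 0)
    rw [zpow_neg_mul_mul_zpow hπ0]
    exact hm 0 0
  · -- (0, 1): the hard entry
    rcases Nat.eq_zero_or_pos n with hn | hn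
    · subst hn
      simpa using hm 0 1
    · rw [mul_comm]
      exact isInteger_entry_zero_one hstar hu hϖ hs hn hm h12 h02 hm12 hm02
  · -- (0, 2)
    convert hm02 using 1
    simp only [_root_.zpow_neg, zpow_natCast]
    field_simp
    ring
  · -- (1, 0)
    exact IsLocalization.isInteger_mul (hm 1 0) (hπint _ (by positivity))
  · -- (1, 1)
    exact hm 1 1
  · -- (1, 2)
    exact hm12
  · -- (2, 0)
    exact IsLocalization.isInteger_mul (IsLocalization.isInteger_mul (hπint _ (by positivity)) (hm 2 0))
      (hπint _ (by positivity))
  · -- (2, 1)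
    exact IsLocalization.isInteger_mul (hπint _ (by positivity)) (hm 2 1)
  · -- (2, 2)
    rw [mul_comm (π ^ _), mul_assoc, ← zpow_add₀ hπ0, add_neg_cancel, zpow_zero, mul_one]
    exact hm 2 2

end Matrix

end Summit.Ventures.HodgeRepro2.T5InertTopCoefficientMatrix
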